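import Summits.QuantumFields.YangMills.Theses.MirrorModularBoosts
import Literature.MathematicalPhysics.QuantumFieldTheory.OSReconstructionNoE1Proofs
import Literature.MathematicalPhysics.QuantumFieldTheory.OSSectorContinuation
import Literature.MathematicalPhysics.QuantumFieldTheory.OSHolomorphicVectors
import Summits.QuantumFields.YangMills.Theorems.MirrorModularBoostsPlanarSpectralConeDiscSections
import Summits.QuantumFields.YangMills.Theorems.MirrorModularBoostsPlanarSpectralConeOneGapKernel
import Summits.QuantumFields.YangMills.Theorems.MirrorModularBoostsPlanarSpectralConeOneGapBounds
import Summits.QuantumFields.YangMills.Theorems.MirrorModularBoostsPlanarSpectralConeOneGapForm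
import Summits.QuantumFields.YangMills.Theorems.MirrorModularBoostsPlanarSpectralConeOneGapSector
import Summits.QuantumFields.YangMills.Theorems.MirrorModularBoostsPlanarSpectralConeFrontEnd
import Summits.QuantumFields.YangMills.Theorems.MirrorModularBoostsPlanarSpectralConeDelayedLever
import Summits.QuantumFields.YangMills.Theorems.MirrorModularBoostsPlanarSpectralConeSpanLinearity
import Summits.QuantumFields.YangMills.Theorems.MirrorModularBoostsPlanarSpectralConeTransfer
import Summits.QuantumFields.YangMills.Theorems.MirrorModularBoostsPlanarSpectralConeWindowedDensity
import Summits.QuantumFields.YangMills.Theorems.MirrorModularBoostsPlanarSpectralConeDensityOfParts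
import HarnessLib

/-!
# Crux `MirrorModularBoosts.PlanarSpectralCone` (stmt-QuantumFields-9664) — line `positivity-disc-to-operator-cone`

`PlanarSpectralCone_of : MirrorModularBoosts.PlanarSpectralCone` (no hypotheses): the planar spectral
cone `spec(H, P₁) ⊂ {E ≥ |p₁|}` for a one-species Schwinger family on `ℝ⁴` with E0', E3, translations
on `⁰𝒮` and reflection positivity in the eight frames of the `(x₀,x₁)`-plane. Composition of the
line's seven stubs, landed as `Theorems/MirrorModularBoostsPlanarSpectralCone*.lean`: FrontEnd
(`stub_discSections`), DelayedLever (`stub_cone_of_discSections`), SpanLinearity (`stub_linearity`),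
Transfer (`stub_transfer`), WindowedDensity, DensityOfParts, and `stub_oneGap`, proved IN THIS FILE
from OneGapKernel/Bounds/Form/Sector: the Gram kernel of a one-gap stretching is two-slot sector
data, the tree engine continues it, `exists_holomorphic_gramVec` (`m = 1`) makes the stretching a
holomorphic `ℋ`-valued map on `{0 < Re ζ, |Im ζ| < Re ζ}`, and the identity theorem propagates
orthogonality from `[s₀,∞)` to all `s ≥ 0` (OS II, Ch. V, at one gap, E1-free, E0'-free). The glue
(`osReconstruction_e0`, `planarConeSupport_of_parts`, `PlanarSpectralCone_of`) is that of the
registered skeleton `Cruxes/PlanarSpectralCone/Lines/positivity-disc-to-operator-cone.lean`.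
`E4` is local notation for `EuclideanSpace ℝ (Fin 4)`.
-/

noncomputable section

namespace Summit.QuantumFields.YangMills.Cruxes.PlanarSpectralCone.PositivityDiscToOperatorCone

open MeasureTheory Complex Set Filter
open scoped InnerProductSpace SchwartzMap ComplexConjugate Topology
open Literature.MathematicalPhysics.QuantumLattice Literature.MathematicalPhysics.AQFT
  Literature.MathematicalPhysics.QuantumFieldTheory
open Literature.Analysis.Complex

local notation "E4" => EuclideanSpace ℝ (Fin 4)

namespace OneGap

/-! ### Geometry of the one-slot domain `Ω = {0 < Re ζ, |Im ζ| < Re ζ}` -/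

/-- A point of the disc `D(2x, √2 x)` (`x > 0`) has `|Im w| < Re w`: with `a = Re w − 2x`, `b = Im w`
one has `a² + b² < 2x²`, so `b² < 2x² − a² ≤ (2x + a)²`. -/
theorem abs_im_lt_re_of_mem_ball {x : ℝ} (hx : 0 < x) {w : ℂ} (hw : w ∈ Metric.ball ((2 * x : ℝ) : ℂ) (Real.sqrt 2 * x)) :
    0 < w.re ∧ |w.im| < w.re := by
  rw [Metric.mem_ball, dist_eq_norm] at hw
  have h2 : ‖w - ((2 * x : ℝ) : ℂ)‖ ^ 2 < (Real.sqrt 2 * x) ^ 2 := by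
    exact pow_lt_pow_left₀ hw (norm_nonneg _) two_ne_zero
  rw [mul_pow, Real.sq_sqrt zero_le_two, Complex.sq_norm, Complex.normSq_apply] at h2
  simp only [Complex.sub_re, Complex.ofReal_re, Complex.sub_im, Complex.ofReal_im, sub_zero] at h2
  have hre : 0 < w.re := by nlinarith [sq_nonneg w.im, sq_nonneg (w.re - 2 * x)]
  refine ⟨hre, abs_lt_of_sq_lt_sq ?_ hre.le⟩
  nlinarith [sq_nonneg (w.re - x)]

/-- `|Im ζ| < Re ζ` for both entries gives a point of the two-slot sector region of opening `π/2`. -/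
theorem pair_mem_sectorRegion {w z : ℂ} (hw : 0 < w.re ∧ |w.im| < w.re) (hz : 0 < z.re ∧ |z.im| < z.re) :
    (![w, z] : Fin 2 → ℂ) ∈ sectorRegion 1 (Real.pi / 2) := by
  refine ⟨fun j => ?_, ?_⟩
  · fin_cases j
    · simpa using hw.1
    · simpa using hz.1
  · have h := TwoMirrorLightconeSlots.DiscSections.abs_arg_add_abs_arg_lt hw.1 hz.1
      (mul_lt_mul'' hw.2 hz.2 (abs_nonneg _) (abs_nonneg _))
    rw [Fin.sum_univ_two]
    simpa using h

/-- **The holomorphic `ℋ`-valued stretching.** With `T ≥ 0`, `P` below `T`, `Q` above `T` there is a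
map `Ψ̂ : (Fin 1 → ℂ) → ℋ`, holomorphic on `Ω = {z | 0 < Re z₀, |Im z₀| < Re z₀}`, with
`Ψ̂(σ) = Ψ_{P ⊗ Q_{σe₀}}` for every real `σ > 0`. -/
theorem exists_holomorphic_stretch (S : SchwingerFamily E4) (h : OSReconstructionNoE1 S.toLabelled) {k l : ℕ}
    {P : 𝓢((Fin k → E4), ℂ)} {Q : 𝓢((Fin l → E4), ℂ)} {T : ℝ}
    (hP : IsTimeOrdered P) (hQ : IsTimeOrdered Q)
    (hPT : tsupport (P : (Fin k → E4) → ℂ) ⊆ {x | ∀ i, x i 0 < T})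
    (hQT : tsupport (Q : (Fin l → E4) → ℂ) ⊆ {x | ∀ i, T < x i 0}) (hT : 0 ≤ T) :
    ∃ Ψv : (Fin 1 → ℂ) → h.Hilbert,
      DifferentiableOn ℂ Ψv {z : Fin 1 → ℂ | 0 < (z 0).re ∧ |(z 0).im| < (z 0).re} ∧
      ∀ σ : ℝ, ∀ hσ : 0 < σ, Ψv (fun _ => (σ : ℂ)) =
        h.fieldVec (k + l) (fun _ => ()) (P.appendTensor (translateMulti (SchwingerFamily.timeVec σ) Q))
          (isTimeOrdered_stretch hP hQ hPT hQT hσ.le) := by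
  obtain ⟨G, hGd, hGr⟩ := exists_sector_extension S h hP hQ hPT hQT hT
  have hFto : ∀ σ : ℝ, IsTimeOrdered (P.appendTensor (translateMulti (SchwingerFamily.timeVec (max σ 0)) Q)) :=
    fun σ => isTimeOrdered_stretch hP hQ hPT hQT (le_max_right σ 0)
  set W : ℝ → h.Hilbert := fun σ => h.fieldVec (k + l) (fun _ => ())
    (P.appendTensor (translateMulti (SchwingerFamily.timeVec (max σ 0)) Q)) (hFto σ) with hW
  set Ω : Set (Fin 1 → ℂ) := {z | 0 < (z 0).re ∧ |(z 0).im| < (z 0).re} with hΩ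
  have hmain := exists_holomorphic_gramVec (m := 1) (H := h.Hilbert) (Ω := Ω)
    (k := fun w z => G ![w 0, z 0]) (Φ := fun η => W (η 0)) ?_ ?_
  · obtain ⟨Ψv, hΨd, hΨr, -, -⟩ := hmain
    refine ⟨Ψv, hΨd, fun σ hσ => ?_⟩
    have hmem : (fun _ : Fin 1 => ((σ : ℝ) : ℂ)) ∈ Ω := by
      refine ⟨by simpa using hσ, ?_⟩
      simpa using hσ
    have := hΨr (fun _ => σ) hmem
    rw [this, hW]
    exact fieldVec_congr h _ (by rw [max_eq_left hσ.le]) _ _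
  · -- every point of `Ω` lies in a real-centred disc inside `Ω` on whose square `k` is holomorphic
    intro z hz
    obtain ⟨hx, hy⟩ := hz
    set x : ℝ := (z 0).re with hxdef
    refine ⟨fun _ => 2 * x, fun _ => Real.sqrt 2 * x, ?_, fun _ => by positivity, ?_, ?_⟩
    · rw [mem_polydisc]
      intro i
      rw [show i = 0 from Subsingleton.elim i 0, Metric.mem_ball, dist_eq_norm]
      have h2 : ‖z 0 - ((2 * x : ℝ) : ℂ)‖ ^ 2 < (Real.sqrt 2 * x) ^ 2 := by
        rw [mul_pow, Real.sq_sqrt zero_le_two, Complex.sq_norm, Complex.normSq_apply]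
        simp only [Complex.sub_re, Complex.ofReal_re, Complex.sub_im, Complex.ofReal_im, sub_zero]
        have hy' := abs_lt.1 hy
        nlinarith
      exact lt_of_pow_lt_pow_left₀ 2 (by positivity) h2
    · intro w hw
      rw [mem_polydisc] at hw
      exact abs_im_lt_re_of_mem_ball hx (hw 0)
    · have hlin : Differentiable ℂ (fun p : (Fin 1 → ℂ) × (Fin 1 → ℂ) => (![p.1 0, p.2 0] : Fin 2 → ℂ)) := by
        refine differentiable_pi.2 fun j => ?_
        have h1 : Differentiable ℂ fun p : (Fin 1 → ℂ) × (Fin 1 → ℂ) => p.1 0 :=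
          (ContinuousLinearMap.proj (R := ℂ) (φ := fun _ : Fin 1 => ℂ) 0).differentiable.comp differentiable_fst
        have h2 : Differentiable ℂ fun p : (Fin 1 → ℂ) × (Fin 1 → ℂ) => p.2 0 :=
          (ContinuousLinearMap.proj (R := ℂ) (φ := fun _ : Fin 1 => ℂ) 0).differentiable.comp differentiable_snd
        fin_cases j
        · simpa using h1
        · simpa using h2
      refine hGd.comp hlin.differentiableOn fun p hp => ?_
      rw [Set.mem_prod, mem_polydisc, mem_polydisc] at hp
      exact pair_mem_sectorRegion (abs_im_lt_re_of_mem_ball hx (hp.1 0)) (abs_im_lt_re_of_mem_ball hx (hp.2 0))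
  · -- the Gram identity at the real points of `Ω`
    intro η η' hη hη'
    have h0 : 0 < η 0 := by simpa using hη.1
    have h0' : 0 < η' 0 := by simpa using hη'.1
    have hvec : (fun j => (((![η' 0, η 0] : Fin 2 → ℝ) j : ℝ) : ℂ)) = (![((η' 0 : ℝ) : ℂ), ((η 0 : ℝ) : ℂ)] : Fin 2 → ℂ) := by
      funext j; fin_cases j <;> simp
    have hpos : ∀ j, 0 < (![η' 0, η 0] : Fin 2 → ℝ) j := fun j => by fin_cases j <;> simpa
    show ⟪W (η' 0), W (η 0)⟫_ℂ = G ![((η' 0 : ℝ) : ℂ), ((η 0 : ℝ) : ℂ)]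
    rw [← hvec, hGr _ hpos]
    simp only [Matrix.cons_val_zero, Matrix.cons_val_one, Matrix.cons_val_fin_one]
    have e1 : W (η' 0) = h.fieldVec (k + l) (fun _ => ())
        (P.appendTensor (translateMulti (SchwingerFamily.timeVec (η' 0)) Q))
        (isTimeOrdered_stretch hP hQ hPT hQT h0'.le) :=
      fieldVec_congr h _ (by rw [max_eq_left h0'.le]) _ _
    have e2 : W (η 0) = h.fieldVec (k + l) (fun _ => ())
        (P.appendTensor (translateMulti (SchwingerFamily.timeVec (η 0)) Q))
        (isTimeOrdered_stretch hP hQ hPT hQT h0.le) :=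
      fieldVec_congr h _ (by rw [max_eq_left h0.le]) _ _
    rw [e1, e2, inner_fieldVec_fieldVec']
    rfl

/-- The one-gap conclusion for `T ≥ 0`. -/
theorem inner_stretch_eq_zero (S : SchwingerFamily E4) (h : OSReconstructionNoE1 S.toLabelled) {k l : ℕ}
    {P : 𝓢((Fin k → E4), ℂ)} {Q : 𝓢((Fin l → E4), ℂ)} {T : ℝ}
    (hP : IsTimeOrdered P) (hQ : IsTimeOrdered Q)
    (hPT : tsupport (P : (Fin k → E4) → ℂ) ⊆ {x | ∀ i, x i 0 < T})
    (hQT : tsupport (Q : (Fin l → E4) → ℂ) ⊆ {x | ∀ i, T < x i 0}) (hT : 0 ≤ T)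
    (χ : h.Hilbert) (s₀ : ℝ)
    (hχ : ∀ s : ℝ, s₀ ≤ s → 0 ≤ s →
      ∀ hs : IsTimeOrdered (P.appendTensor (translateMulti (SchwingerFamily.timeVec s) Q)),
        ⟪χ, h.fieldVec (k + l) (fun _ => ()) _ hs⟫_ℂ = 0)
    (s : ℝ) (hs0 : 0 ≤ s)
    (hs : IsTimeOrdered (P.appendTensor (translateMulti (SchwingerFamily.timeVec s) Q))) :
    ⟪χ, h.fieldVec (k + l) (fun _ => ()) _ hs⟫_ℂ = 0 := by
  obtain ⟨Ψv, hΨd, hΨr⟩ := exists_holomorphic_stretch S h hP hQ hPT hQT hT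
  -- the scalar function `g ζ = ⟪χ, Ψ̂ ζ⟫` on `U = {0 < Re ζ, |Im ζ| < Re ζ}`
  set U : Set ℂ := {ζ : ℂ | 0 < ζ.re ∧ |ζ.im| < ζ.re} with hU
  set g : ℂ → ℂ := fun ζ => ⟪χ, Ψv (fun _ => ζ)⟫_ℂ with hg
  have hUo : IsOpen U :=
    (isOpen_lt continuous_const Complex.continuous_re).inter
      (isOpen_lt (continuous_abs.comp Complex.continuous_im) Complex.continuous_re)
  have hUc : Convex ℝ U := by
    have e : U = {ζ : ℂ | 0 < ζ.re} ∩ ({ζ : ℂ | ζ.im - ζ.re < 0} ∩ {ζ : ℂ | -ζ.im - ζ.re < 0}) := by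
      ext ζ
      simp only [hU, Set.mem_setOf_eq, Set.mem_inter_iff, abs_lt]
      constructor
      · rintro ⟨h1, h2, h3⟩; exact ⟨h1, by linarith, by linarith⟩
      · rintro ⟨h1, h2, h3⟩; exact ⟨h1, by linarith, by linarith⟩
    rw [e]
    refine (convex_halfSpace_re_gt 0).inter ((convex_halfSpace_lt ?_ 0).inter (convex_halfSpace_lt ?_ 0))
    · exact ⟨fun x y => by simp only [Complex.add_im, Complex.add_re]; ring,
        fun c x => by simp only [Complex.real_smul, Complex.mul_im, Complex.mul_re, Complex.ofReal_re,
          Complex.ofReal_im, zero_mul, sub_zero, add_zero, smul_eq_mul]; ring⟩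
    · exact ⟨fun x y => by simp only [Complex.add_im, Complex.add_re, neg_add]; ring,
        fun c x => by simp only [Complex.real_smul, Complex.mul_im, Complex.mul_re, Complex.ofReal_re,
          Complex.ofReal_im, zero_mul, sub_zero, add_zero, smul_eq_mul]; ring⟩
  have hgd : DifferentiableOn ℂ g U := by
    have h1 : DifferentiableOn ℂ (fun ζ : ℂ => Ψv (fun _ => ζ)) U := by
      refine hΨd.comp (differentiableOn_pi.2 fun _ => differentiableOn_id) fun ζ hζ => ?_
      exact hζ
    exact (innerSL ℂ χ).differentiable.comp_differentiableOn h1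
  -- `g` vanishes at the real points `> max s₀ 0`
  have hg0 : ∀ σ : ℝ, max s₀ 0 < σ → g σ = 0 := by
    intro σ hσ
    have hσ0 : 0 < σ := lt_of_le_of_lt (le_max_right _ _) hσ
    show ⟪χ, Ψv (fun _ => (σ : ℂ))⟫_ℂ = 0
    rw [hΨr σ hσ0]
    exact hχ σ ((le_max_left _ _).trans hσ.le) hσ0.le _
  -- hence on `U` (identity theorem along `z₀ + 1/(n+1)`, `z₀ = max s₀ 0 + 1`)
  set z₀ : ℝ := max s₀ 0 + 1 with hz₀
  have hz₀0 : 0 < z₀ := by have := le_max_right s₀ 0; linarith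
  have hz₀U : ((z₀ : ℝ) : ℂ) ∈ U := ⟨by simpa using hz₀0, by simpa using hz₀0⟩
  have hfreq : ∃ᶠ ζ in 𝓝[≠] ((z₀ : ℝ) : ℂ), g ζ = 0 := by
    refine ((tendsto_ofReal_add_inv_nhdsWithin z₀).frequently
      ((Eventually.of_forall fun n => ?_).frequently))
    show g ((z₀ + 1 / ((n : ℝ) + 1) : ℝ) : ℂ) = 0
    have hpos : (0 : ℝ) < 1 / ((n : ℝ) + 1) := by positivity
    exact hg0 _ (by linarith)
  have hgU : EqOn g 0 U :=
    (hgd.analyticOnNhd hUo).eqOn_zero_of_preconnected_of_frequently_eq_zero hUc.isPreconnected hz₀U hfreq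
  -- conclusion for `s > 0`
  have hpos : ∀ σ : ℝ, ∀ hσ : 0 < σ,
      ⟪χ, h.fieldVec (k + l) (fun _ => ()) (P.appendTensor (translateMulti (SchwingerFamily.timeVec σ) Q))
        (isTimeOrdered_stretch hP hQ hPT hQT hσ.le)⟫_ℂ = 0 := by
    intro σ hσ
    have h1 := hgU (⟨by simpa using hσ, by simpa using hσ⟩ : ((σ : ℝ) : ℂ) ∈ U)
    simp only [hg, Pi.zero_apply] at h1
    rwa [hΨr σ hσ] at h1
  rcases hs0.eq_or_lt with hs0' | hs0'
  · -- `s = 0`: continuity of the stretching at `0`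
    subst hs0'
    have hlim : Tendsto (fun n : ℕ => P.appendTensor (translateMulti (SchwingerFamily.timeVec (1 / ((n : ℝ) + 1))) Q))
        atTop (𝓝 (P.appendTensor (translateMulti (SchwingerFamily.timeVec 0) Q))) :=
      ((continuous_stretch P Q).tendsto 0).comp tendsto_one_div_add_atTop_nhds_zero_nat
    have ht := tendsto_fieldVec h (fun _ => ()) (fun n : ℕ => isTimeOrdered_stretch hP hQ hPT hQT
      (by positivity : (0 : ℝ) ≤ 1 / ((n : ℝ) + 1))) hs hlim
    have ht' : Tendsto (fun n : ℕ => ⟪χ, h.fieldVec (k + l) (fun _ => ())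
        (P.appendTensor (translateMulti (SchwingerFamily.timeVec (1 / ((n : ℝ) + 1))) Q))
        (isTimeOrdered_stretch hP hQ hPT hQT (by positivity : (0 : ℝ) ≤ 1 / ((n : ℝ) + 1)))⟫_ℂ)
        atTop (𝓝 ⟪χ, h.fieldVec (k + l) (fun _ => ())
          (P.appendTensor (translateMulti (SchwingerFamily.timeVec 0) Q)) hs⟫_ℂ) :=
      (tendsto_const_nhds (x := χ)).inner ht
    have h0 : Tendsto (fun n : ℕ => ⟪χ, h.fieldVec (k + l) (fun _ => ())
        (P.appendTensor (translateMulti (SchwingerFamily.timeVec (1 / ((n : ℝ) + 1))) Q))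
        (isTimeOrdered_stretch hP hQ hPT hQT (by positivity : (0 : ℝ) ≤ 1 / ((n : ℝ) + 1)))⟫_ℂ)
        atTop (𝓝 0) := by
      have : ∀ n : ℕ, ⟪χ, h.fieldVec (k + l) (fun _ => ())
          (P.appendTensor (translateMulti (SchwingerFamily.timeVec (1 / ((n : ℝ) + 1))) Q))
          (isTimeOrdered_stretch hP hQ hPT hQT (by positivity : (0 : ℝ) ≤ 1 / ((n : ℝ) + 1)))⟫_ℂ = 0 :=
        fun n => hpos _ (by positivity)
      simp only [this]
      exact tendsto_const_nhds
    exact tendsto_nhds_unique ht' h0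
  · exact hpos s hs0'

end OneGap

/-- **Stub 3a — ONE GAP** (registered stub; OS II Ch. V at one gap, E1-free): for `P` (`k` points,
times `< T`) and `Q` (`l` points, times `> T`) time-ordered and `Ψ(s) = Ψ_{P ⊗ Q_{s e₀}}`, if
`χ ⊥ Ψ(s)` for all `s ≥ s₀` then `χ ⊥ Ψ(s)` for all `s ≥ 0`. Proof: replace `T` by `max T 0` and
apply `OneGap.inner_stretch_eq_zero`. -/
theorem stub_oneGap (S : SchwingerFamily E4) (h : OSReconstructionNoE1 S.toLabelled)
    {k l : ℕ} (P : 𝓢((Fin k → E4), ℂ)) (Q : 𝓢((Fin l → E4), ℂ)) (T : ℝ)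
    (hP : IsTimeOrdered P) (hQ : IsTimeOrdered Q)
    (hPT : tsupport (P : (Fin k → E4) → ℂ) ⊆ {x | ∀ i, x i 0 < T})
    (hQT : tsupport (Q : (Fin l → E4) → ℂ) ⊆ {x | ∀ i, T < x i 0})
    (χ : h.Hilbert) (s₀ : ℝ)
    (hχ : ∀ s : ℝ, s₀ ≤ s → 0 ≤ s →
      ∀ hs : IsTimeOrdered (P.appendTensor (translateMulti (SchwingerFamily.timeVec s) Q)),
        ⟪χ, h.fieldVec (k + l) (fun _ => ()) _ hs⟫_ℂ = 0)
    (s : ℝ) (hs0 : 0 ≤ s)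
    (hs : IsTimeOrdered (P.appendTensor (translateMulti (SchwingerFamily.timeVec s) Q))) :
    ⟪χ, h.fieldVec (k + l) (fun _ => ()) _ hs⟫_ℂ = 0 := by
  have hPT' : tsupport (P : (Fin k → E4) → ℂ) ⊆ {x | ∀ i, x i 0 < max T 0} :=
    fun x hx i => (hPT hx i).trans_le (le_max_left _ _)
  have hQT' : tsupport (Q : (Fin l → E4) → ℂ) ⊆ {x | ∀ i, max T 0 < x i 0} :=
    fun x hx i => max_lt (hQT hx i) ((hQ hx).1 i)
  exact OneGap.inner_stretch_eq_zero S h hP hQ hPT' hQT' (le_max_right _ _) χ s₀ hχ s hs0 hs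


/-- **DENSITY of cone-chain vectors** (the original stub 3 of the line, now GLUE): composition of
`stub_density_of_parts` with `stub_oneGap` and `stub_windowedDensity`. In the `e₀`-OS space of a
family with E2 and translations on `⁰𝒮`, the field vectors `Ψ_G` of strict cone chains `G` (all
arities) span a dense subspace. (`hlg`, `hsym` are passed through and idle.) -/
theorem stub_density (S : SchwingerFamily E4) (hlg : S.toLabelled.HasLinearGrowth)
    (hsym : S.toLabelled.IsSymmetric) (h : OSReconstructionNoE1 S.toLabelled) :
    Dense ((Submodule.span ℂ
      {ψ : h.Hilbert | ∃ (m : ℕ) (G : 𝓢((Fin m → E4), ℂ)) (hG : IsTimeOrdered G),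
        tsupport (G : (Fin m → E4) → ℂ) ⊆
          {x | (∀ i, |x i 1| < x i 0) ∧ ∀ i j, i < j → |x j 1 - x i 1| < x j 0 - x i 0} ∧
        ψ = h.fieldVec m (fun _ => ()) G hG} : Submodule ℂ h.Hilbert) : Set h.Hilbert) :=
  stub_density_of_parts stub_oneGap stub_windowedDensity S hlg hsym h

/-! ## Glue (sorry-free, kernel-checked) -/

/-- The pull-back by the identity frame is the family itself (`linActMulti 1 F = F` pointwise). -/
theorem pullback_refl (S : SchwingerFamily E4) :
    (fun n => (S n).comp (linActMulti (LinearIsometryEquiv.refl ℝ E4))) = S := by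
  funext n
  refine ContinuousLinearMap.ext fun F => ?_
  have hF : linActMulti (LinearIsometryEquiv.refl ℝ E4) F = F := SchwartzMap.ext fun _ => rfl
  rw [ContinuousLinearMap.comp_apply, hF]

/-- **The `e₀`-frame OS reconstruction exists under the crux hypotheses**: E2 of `S.toLabelled` is
the eight-frame hypothesis at the frame `R = 1` (`a = 1`, `b = 0`; honours cdisprove
`false_without_axisFrames`: the `e₀` mirror is load-bearing exactly here), translation invariance on
`⁰𝒮` is the crux hypothesis relabelled (`S.toLabelled n k = S n`). -/
theorem osReconstruction_e0 (S : SchwingerFamily E4)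
    (htr : ∀ (n : ℕ) (a : E4) (F : 𝓢((Fin n → E4), ℂ)), IsOffDiagonal F →
      S n (translateMulti a F) = S n F)
    (hRP : ∀ (R : E4 ≃ₗᵢ[ℝ] E4) (a b : ℝ), a ^ 2 + b ^ 2 = 1 → (a = 0 ∨ b = 0 ∨ a ^ 2 = b ^ 2) →
      R (EuclideanSpace.single 0 1) = a • EuclideanSpace.single 0 1 + b • EuclideanSpace.single 1 1 →
        (SchwingerFamily.toLabelled (fun n => (S n).comp (linActMulti R))).IsReflectionPositive) :
    OSReconstructionNoE1 S.toLabelled := by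
  refine ⟨?_, fun n k a F hF => htr n a F hF⟩
  have h1 := hRP (LinearIsometryEquiv.refl ℝ E4) 1 0 (by norm_num) (Or.inr (Or.inl rfl)) (by simp)
  rwa [pullback_refl] at h1

/-- The complement `{p₀ < |p₁|}` of the closed planar cone is open, hence Borel. -/
theorem measurableSet_coneCompl : MeasurableSet {p : E4 | p 0 < |p 1|} := by
  have h0 : Continuous fun p : E4 => p 0 := by fun_prop
  have h1 : Continuous fun p : E4 => |p 1| := by fun_prop
  exact (isOpen_lt h0 h1).measurableSet

/-- `⟪b e₁, p⟫ = b p₁` — matches the Fourier phase of `IsJointSpectralMeasure` at `a = b e₁` with the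
integrand of stub 2. -/
theorem inner_single_one (b : ℝ) (p : E4) :
    ⟪EuclideanSpace.single (1 : Fin 4) b, p⟫_ℝ = b * p 1 := by
  simp [EuclideanSpace.inner_single_left]

/-- **ARROW FORM — stubs 1–4 ⇒ the transfer target `C⁺`**: with the statements of `stub_discSections`,
`stub_cone_of_discSections`, `stub_density`, `stub_linearity` as hypotheses, every joint spectral measure
of every vector of the `e₀`-OS space is carried by the closed planar cone `{p₀ ≥ |p₁|}`. -/
theorem planarConeSupport_of_parts
    (h_disc : ∀ (S : SchwingerFamily E4), S.toLabelled.HasLinearGrowth → S.toLabelled.IsSymmetric →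
      (∀ (n : ℕ) (a : E4) (F : 𝓢((Fin n → E4), ℂ)), IsOffDiagonal F →
        S n (translateMulti a F) = S n F) →
      (∀ (R : E4 ≃ₗᵢ[ℝ] E4) (a b : ℝ), a ^ 2 + b ^ 2 = 1 → (a = 0 ∨ b = 0 ∨ a ^ 2 = b ^ 2) →
        R (EuclideanSpace.single 0 1) = a • EuclideanSpace.single 0 1 + b • EuclideanSpace.single 1 1 →
          (SchwingerFamily.toLabelled (fun n => (S n).comp (linActMulti R))).IsReflectionPositive) →
      ∀ (h : OSReconstructionNoE1 S.toLabelled) {m : ℕ} (G : 𝓢((Fin m → E4), ℂ))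
        (hG : IsTimeOrdered G),
        tsupport (G : (Fin m → E4) → ℂ) ⊆
          {x | (∀ i, |x i 1| < x i 0) ∧ ∀ i j, i < j → |x j 1 - x i 1| < x j 0 - x i 0} →
        ∃ c M : ℝ, 0 ≤ c ∧ ∀ t : ℝ, c < t → ∃ f : ℂ → ℂ,
          DifferentiableOn ℂ f (Metric.ball 0 (t - c)) ∧
            (∀ z ∈ Metric.ball (0 : ℂ) (t - c), ‖f z‖ ≤ M) ∧
              ∀ b : ℝ, |b| < t - c →
                f b = ⟪h.fieldVec m (fun _ => ()) G hG, h.transfer t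
                  (h.translate (EuclideanSpace.single 1 b) (h.fieldVec m (fun _ => ()) G hG))⟫_ℂ)
    (h_cone : ∀ (μ : Measure E4) [IsFiniteMeasure μ], μ {p | p 0 < 0} = 0 → ∀ (c M : ℝ), 0 ≤ c →
      (∀ t : ℝ, c < t → ∃ f : ℂ → ℂ,
        DifferentiableOn ℂ f (Metric.ball 0 (t - c)) ∧
          (∀ z ∈ Metric.ball (0 : ℂ) (t - c), ‖f z‖ ≤ M) ∧
            ∀ b : ℝ, |b| < t - c →
              f b = ∫ p, Complex.exp ((((-(t * p 0) : ℝ)) : ℂ) + ((b * p 1 : ℝ) : ℂ) * Complex.I) ∂μ) →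
      μ {p | p 0 < |p 1|} = 0)
    (h_dense : ∀ (S : SchwingerFamily E4), S.toLabelled.HasLinearGrowth → S.toLabelled.IsSymmetric →
      ∀ (h : OSReconstructionNoE1 S.toLabelled),
        Dense ((Submodule.span ℂ
          {ψ : h.Hilbert | ∃ (m : ℕ) (G : 𝓢((Fin m → E4), ℂ)) (hG : IsTimeOrdered G),
            tsupport (G : (Fin m → E4) → ℂ) ⊆
              {x | (∀ i, |x i 1| < x i 0) ∧ ∀ i j, i < j → |x j 1 - x i 1| < x j 0 - x i 0} ∧
            ψ = h.fieldVec m (fun _ => ()) G hG} : Submodule ℂ h.Hilbert) : Set h.Hilbert))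
    (h_lin : ∀ {ι : Type} {d : ℕ} [NeZero d]
      {S : LabelledSchwingerFamily ι (EuclideanSpace ℝ (Fin d))} (h : OSReconstructionNoE1 S)
      {N : Set (EuclideanSpace ℝ (Fin d))}, MeasurableSet N → ∀ {D : Set h.Hilbert},
        Dense ((Submodule.span ℂ D : Submodule ℂ h.Hilbert) : Set h.Hilbert) →
        (∀ ψ ∈ D, ∀ μ : Measure (EuclideanSpace ℝ (Fin d)), h.IsJointSpectralMeasure ψ μ →
          μ N = 0) →
          ∀ (ψ : h.Hilbert) (μ : Measure (EuclideanSpace ℝ (Fin d))),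
            h.IsJointSpectralMeasure ψ μ → μ N = 0)
    (S : SchwingerFamily E4) (hlg : S.toLabelled.HasLinearGrowth) (hsym : S.toLabelled.IsSymmetric)
    (htr : ∀ (n : ℕ) (a : E4) (F : 𝓢((Fin n → E4), ℂ)), IsOffDiagonal F →
      S n (translateMulti a F) = S n F)
    (hRP : ∀ (R : E4 ≃ₗᵢ[ℝ] E4) (a b : ℝ), a ^ 2 + b ^ 2 = 1 → (a = 0 ∨ b = 0 ∨ a ^ 2 = b ^ 2) →
      R (EuclideanSpace.single 0 1) = a • EuclideanSpace.single 0 1 + b • EuclideanSpace.single 1 1 →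
        (SchwingerFamily.toLabelled (fun n => (S n).comp (linActMulti R))).IsReflectionPositive)
    (h : OSReconstructionNoE1 S.toLabelled) (ψ : h.Hilbert) (μ : Measure E4)
    (hμ : h.IsJointSpectralMeasure ψ μ) :
    μ {p | p 0 < |p 1|} = 0 := by
  refine h_lin h measurableSet_coneCompl (h_dense S hlg hsym h) ?_ ψ μ hμ
  rintro ψ' ⟨m, G, hG, hC, rfl⟩ μ' hμ'
  obtain ⟨c, M, hc, hdisc⟩ := h_disc S hlg hsym htr hRP h G hG hC
  haveI := hμ'.isFiniteMeasure
  refine h_cone μ' hμ'.energy_nonneg c M hc fun t ht => ?_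
  obtain ⟨f, hf, hfM, hfb⟩ := hdisc t ht
  refine ⟨f, hf, hfM, fun b hb => ?_⟩
  rw [hfb b hb, hμ'.inner_transfer_translate t (hc.trans_lt ht).le (EuclideanSpace.single 1 b)
    (by simp)]
  simp_rw [inner_single_one]

/-- **THE CRUX FROM THE LINE, BY NAME** — `MirrorModularBoosts.PlanarSpectralCone` from the five
stubs and nothing else: build the `e₀`-OS space (`osReconstruction_e0`), get the transfer target `C⁺`
from stubs 1–4 (`planarConeSupport_of_parts`), and conclude with stub 5. No hypotheses; the only
`sorry`s in its cone are the five `stub_*`. -/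
theorem PlanarSpectralCone_of :
    Summit.QuantumFields.YangMills.Theses.MirrorModularBoosts.PlanarSpectralCone := by
  intro S hlg hsym htr hRP n m F G hF hG
  have h : OSReconstructionNoE1 S.toLabelled := osReconstruction_e0 S htr hRP
  exact stub_transfer S h
    (planarConeSupport_of_parts stub_discSections stub_cone_of_discSections stub_density
      stub_linearity S hlg hsym htr hRP h) n m F G hF hG

end Summit.QuantumFields.YangMills.Cruxes.PlanarSpectralCone.PositivityDiscToOperatorCone
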